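import Mathlib
import HarnessLib
import Literature.Analysis.FluidPDE.SuitableWeak
import Literature.Analysis.FluidPDE.SelfSimilar
import Literature.Analysis.FluidPDE.LocalTypeI
import Literature.Analysis.FluidPDE.LocalTypeIScaling
import Summits.NavierStokesRegularity.NavierStokesRegularity.Theorems.TypeIQuarterGateSliceBudgetV7Defs
import Summits.NavierStokesRegularity.NavierStokesRegularity.Theorems.TypeIQuarterGateScarEnvelopeTypeIFatKill

/-!
# Crux `TypeIQuarterGate.ScarEnvelopeTypeI` (stmt-NavierStokesRegularity-23843), line `slice_budget` —
# the residual twin-scar object cannot be SELF-SIMILAR: width of the fat kill on the self-similar stratum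

Helper file (no new definitions).  The open stub SK of line `slice_budget` (equivalently scar_zoom's S_C′)
asks to exclude an Albritton–Barker-class Type-I ancient mild object singular at the final time at the
origin AND at a point of the unit sphere.  The landed fat kill SF (`stub_fatKill`, p622339: the
final-time singular set of every `ABClass` object is `H¹`-null — CKN at the top time under the Morrey
bound, p620112/p620447) settles the SELF-SIMILAR stratum of that residual with no Liouville input:

* `mem_finalSingularSet_smul_iff` — for a backward self-similar field (`IsSelfSimilar U`:
  `c • U(c² s, c y) = U(s, y)` for all `c > 0`) the final-time singular set is invariant under every
  dilation: `c • x ∈ finalSingularSet U ↔ x ∈ finalSingularSet U` (the `L^∞` norms on backward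
  cylinders scale, `eLpNorm_top_nsZoom`);
* `finalSingularSet_subset_zero_of_isSelfSimilar` — an `ABClass` object which is self-similar has
  `finalSingularSet U ⊆ {0}`: a singular `e ≠ 0` would put the radial segment `[1,2]·e` (an isometric
  copy of an interval of length `‖e‖`, `μH[1] = ‖e‖ > 0`) inside an `H¹`-null set;
* `not_mem_finalSingularSet_of_isSelfSimilar` — in particular NO self-similar `ABClass` object is a
  twin-scar object (`‖e‖ = 1 → e ∉ finalSingularSet U`).

So on the self-similar stratum the residual enemy of 23843 is EXCLUDED IN TREE (for bounded or
unbounded profiles alike: no decay of the profile is assumed, only `𝐈 < ⊤`); for `λ`-DSS objects the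
same argument leaves exactly the `λ`-geometric dusts `{λ^k e}` (H¹-null) — the census's residual.

HONEST FRAMING: bookkeeping on the residual; SK, SD, the crux `ScarEnvelopeTypeI`, its parent and the
summit are OPEN and nothing here is credited toward them.
-/

noncomputable section

-- the summit-side namespace `Summit.NavierStokesRegularity.NavierStokesRegularity.…` (single-conjunct
-- summit, D-0017) repeats a component by design; the dupNamespace linter would flag every declaration.
set_option linter.dupNamespace false

namespace Summit.NavierStokesRegularity.NavierStokesRegularity.Cruxes.ScarEnvelopeTypeI.SliceBudget

open MeasureTheory Set Function Filter Topology Metric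
open scoped ENNReal NNReal
open Literature.Analysis Literature.Analysis.FluidPDE

/-! ### Dilation invariance of the final-time singular set of a self-similar field -/

/-- For a self-similar field the Navier–Stokes zoom about the origin is the field itself:
`c • U(c²·, c·) = U`. -/
theorem smul_stPull_eq_self_of_isSelfSimilar
    {U : ℝ → EuclideanSpace ℝ (Fin 3) → EuclideanSpace ℝ (Fin 3)} (hss : IsSelfSimilar U)
    {c : ℝ} (hc : 0 < c) :
    c • stPull (c ^ 2) c 0 (0 : EuclideanSpace ℝ (Fin 3)) U = U := by
  have h := hss c hc
  funext s y
  have h1 := congrFun (congrFun h s) y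
  rw [nsRescale_apply] at h1
  rw [smul_stPull_apply, zero_add, zero_add]
  exact h1

/-- **Dilation invariance of the final-time singular set of a self-similar field**: for `c > 0`,
`c • x` is a final-time backward singular point iff `x` is (the `L^∞` norms on backward cylinders at
the top scale by `c`, `eLpNorm_top_nsZoom`). -/
theorem mem_finalSingularSet_smul_iff
    {U : ℝ → EuclideanSpace ℝ (Fin 3) → EuclideanSpace ℝ (Fin 3)} (hss : IsSelfSimilar U)
    {c : ℝ} (hc : 0 < c) (x : EuclideanSpace ℝ (Fin 3)) :
    c • x ∈ finalSingularSet U ↔ x ∈ finalSingularSet U := by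
  have hkey : ∀ r : ℝ, eLpNorm (uncurry U) ∞ (volume.restrict
      (parabolicCylinder r (((0 : ℝ), x) : ℝ × EuclideanSpace ℝ (Fin 3)))) =
      ENNReal.ofReal c * eLpNorm (uncurry U) ∞ (volume.restrict
        (parabolicCylinder (c * r) (((0 : ℝ), c • x) : ℝ × EuclideanSpace ℝ (Fin 3)))) := by
    intro r
    have h := eLpNorm_top_nsZoom hc 0 (0 : EuclideanSpace ℝ (Fin 3)) r
      (((0 : ℝ), x) : ℝ × EuclideanSpace ℝ (Fin 3)) U
    rw [smul_stPull_eq_self_of_isSelfSimilar hss hc] at h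
    have hz : stAffine (c ^ 2) c 0 (0 : EuclideanSpace ℝ (Fin 3))
        (((0 : ℝ), x) : ℝ × EuclideanSpace ℝ (Fin 3)) = ((0 : ℝ), c • x) := by
      rw [stAffine_apply, mul_zero, zero_add, zero_add]
    rw [hz] at h
    exact h
  have hc0 : ENNReal.ofReal c ≠ 0 := (ENNReal.ofReal_pos.2 hc).ne'
  simp only [finalSingularSet, mem_setOf_eq, IsBackwardSingularPoint]
  constructor
  · intro h r hr
    rw [hkey r]
    have h' := h (c * r) (mul_pos hc hr)
    rw [h']
    exact ENNReal.mul_top hc0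
  · intro h r hr
    -- `r = c * (r / c)`
    have hrc : 0 < r / c := div_pos hr hc
    have h' := h (r / c) hrc
    rw [hkey (r / c), mul_div_cancel₀ _ hc.ne'] at h'
    rcases ENNReal.mul_eq_top.1 h' with ⟨-, htop⟩ | ⟨htop, -⟩
    · exact htop
    · exact absurd htop ENNReal.ofReal_ne_top

/-! ### The self-similar stratum of the residual -/

/-- **A self-similar object of the Albritton–Barker class has final-time singular set `⊆ {0}`.**  By the
fat kill SF (`stub_fatKill`) the final-time singular set is `H¹`-null; by self-similarity it is dilation
invariant; a point `e ≠ 0` in it would put the segment `{s • e : 1 ≤ s ≤ 2}` — the isometric image of an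
interval of length `‖e‖` — inside it, of positive `H¹`-measure. -/
theorem finalSingularSet_subset_zero_of_isSelfSimilar {M : ℝ}
    {U : ℝ → EuclideanSpace ℝ (Fin 3) → EuclideanSpace ℝ (Fin 3)}
    {P : ℝ → EuclideanSpace ℝ (Fin 3) → ℝ}
    {H : ℝ → EuclideanSpace ℝ (Fin 3) → EuclideanSpace ℝ (Fin 3) →L[ℝ] EuclideanSpace ℝ (Fin 3)}
    (hAB : ABClass M U P H) (hss : IsSelfSimilar U) :
    finalSingularSet U ⊆ {0} := by
  intro e he
  by_contra hne
  have hne' : e ≠ 0 := hne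
  have hpos : 0 < ‖e‖ := norm_pos_iff.2 hne'
  -- the isometric parametrisation of the ray through `e`
  set g : ℝ → EuclideanSpace ℝ (Fin 3) := fun s => (s / ‖e‖) • e with hg
  have hiso : Isometry g := by
    refine Isometry.of_dist_eq fun s t => ?_
    rw [dist_eq_norm, dist_eq_norm, hg]
    dsimp only
    rw [← sub_smul, norm_smul, ← sub_div, Real.norm_eq_abs, abs_div, abs_of_pos hpos,
      div_mul_cancel₀ _ hpos.ne', Real.norm_eq_abs]
  -- the segment lies in the final-time singular set
  have hseg : g '' Icc ‖e‖ (2 * ‖e‖) ⊆ finalSingularSet U := by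
    rintro _ ⟨s, hs, rfl⟩
    have hs0 : 0 < s / ‖e‖ := div_pos (hpos.trans_le hs.1) hpos
    exact (mem_finalSingularSet_smul_iff hss hs0 e).2 he
  -- its `H¹`-measure is `‖e‖ > 0`
  have hmeas : μH[1] (g '' Icc ‖e‖ (2 * ‖e‖)) = ENNReal.ofReal ‖e‖ := by
    rw [hiso.hausdorffMeasure_image (Or.inl zero_le_one), hausdorffMeasure_real, Real.volume_Icc]
    congr 1; ring
  have hnull : μH[1] (finalSingularSet U) = 0 := stub_fatKill M U P H hAB
  have hzero : μH[1] (g '' Icc ‖e‖ (2 * ‖e‖)) = 0 := measure_mono_null hseg hnull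
  rw [hmeas] at hzero
  exact absurd hzero (ENNReal.ofReal_pos.2 hpos).ne'

/-- **No self-similar A–B-class twin-scar object**: a self-similar object of the class `ABClass` has no
final-time singular point on the unit sphere — the self-similar stratum of 23843's residual enemy is
excluded in the tree (no decay of the profile assumed). -/
theorem not_mem_finalSingularSet_of_isSelfSimilar {M : ℝ}
    {U : ℝ → EuclideanSpace ℝ (Fin 3) → EuclideanSpace ℝ (Fin 3)}
    {P : ℝ → EuclideanSpace ℝ (Fin 3) → ℝ}
    {H : ℝ → EuclideanSpace ℝ (Fin 3) → EuclideanSpace ℝ (Fin 3) →L[ℝ] EuclideanSpace ℝ (Fin 3)}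
    (hAB : ABClass M U P H) (hss : IsSelfSimilar U) (e : EuclideanSpace ℝ (Fin 3)) (he : ‖e‖ = 1) :
    e ∉ finalSingularSet U := by
  intro hmem
  have h0 : e = 0 := finalSingularSet_subset_zero_of_isSelfSimilar hAB hss hmem
  rw [h0, norm_zero] at he
  exact zero_ne_one he

end Summit.NavierStokesRegularity.NavierStokesRegularity.Cruxes.ScarEnvelopeTypeI.SliceBudget

end
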